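import Literature.Barriers.Parity.SiegelZeroPrimePairsSieveLemma33
import Literature.NumberTheory.Sieve.BetaSievePointwise
import Literature.NumberTheory.LFunctions.RealCharacterDivisorSumsMultiples
import Literature.NumberTheory.LFunctions.SiegelZeroSiftedEulerProduct
import HarnessLib

/-!
# At a Siegel zero, `λ = 1 ∗ χ` has density `≪ 1/(η log q)` on the rough integers

Topic `Literature/Barriers/Parity` (the analytic input of the "Siegel-zero model of the primes"
`λ = 1 ∗ χ`; sibling of the `SiegelZeroPrimePairs*` files).  Everything in this file is PROVED
(theorems only).  For `ε > 0` there are `K, η₀` such that for every primitive quadratic `χ (mod q)`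
with the real zero `1 − 1/(η log q)`, `η ≥ η₀`, every real `z ≥ q^{(1+ε)/2} + 1` and every `y > 0`:

  `∑_{m ≤ y, (m, P(z)) = 1} λ(m) ≤ K ( y/(η log q) + q z^{124} √y )`

(`MatomakiMerikoski.sum_rough_charDivisorSum_le_of_exceptionalZero`; `λ = RealChar.charDivisorSum χ ≥ 0`,
`P(z) = primesProdBelow z`).  That is: on the integers free of prime factors `< z` the NATURAL density of
`λ` is `≪ 1/(η log q)`, uniformly in `z` and `y` — the natural-density companion of the logarithmic
statements of Matomäki–Merikoski's Lemmas 2.2 and 4.1 (`∑_{z ≤ m ≤ Y rough} λ(m)/m ≪ …`, tree: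
`SiegelZero.MatomakiMerikoski2023_lemma22`), which those lemmas do not imply (the term `m = 1`).

Proof: the upper `β`-sieve (`BetaSieve.upper_sieve`, weights `μ(d)χ⁺(d)` of level `D = z^{62}`,
`β = 62`, `A = 1`, sifting by the ODD primes `< z` so that the density at `2` stays `≤ 2/3`) applied to
the non-negative sequence `(λ(m))_{m ≤ y}`, whose distribution on multiples of a squarefree `d` is
`L(1,χ) y ∏_{p ∣ d} g(p) + O(q 2^{ω(d)} √y)`, `g(p) = (1+χ(p))/p − χ(p)/p²`
(`RealChar.abs_sum_multiples_charDivisorSum_sub_le`, Davenport Ch. 6); the main term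
`L(1,χ) y ∑_{d} μ(d)χ⁺(d) g(d) ≤ (1 + C) L(1,χ) y ∏_{2 < p < z} (1 − g(p))`
(`MatomakiMerikoski.abs_upperSieveSum_sub_vprod_le`, Matomäki–Merikoski Lemma 3.2 (ii)) is
`≤ 4(1+C) y · L(1,χ)∏_{p<z}(1 − 1/p)(1 − χ(p)/p) ≤ 16 (1+C) y/(η log q)` by the sifted Euler product
bound at the exceptional zero (`SiegelZero.exists_LFunction_one_mul_siftedEuler_le`, Tao–Teräväinen
(3.15)); the remainders add up to `≤ 5 q D² √y`.

## References

* T. Tao, J. Teräväinen, J. London Math. Soc. (2) 106 (2022), §3.3 (3.15). [cite: TaoTeravainen2021, §3.3 (3.15)]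
* K. Matomäki, J. Merikoski, IMRN 2023 (arXiv:2112.11412), Lemma 3.2 (ii). [cite: MatomakiMerikoski2023, Lemma 3.2 (ii)]
* H. Davenport, *Multiplicative Number Theory*, Ch. 6, (4). [cite: DavenportMNT1980, Ch. 6, (4)]
-/

noncomputable section

open Finset Real
open scoped ArithmeticFunction.Moebius

namespace Literature.Barriers.Parity.MatomakiMerikoski

open Literature.NumberTheory.Sieve Literature.NumberTheory.Sieve.BetaSieve
open Literature.NumberTheory.LFunctions
open Literature.NumberTheory.LFunctions.RealChar (charDivisorSum charDivisorSum_nonneg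
  abs_sum_multiples_charDivisorSum_sub_le one_sub_localDensity)
open Literature.NumberTheory.LFunctions.DirichletAbel (reChar reChar_apply reChar_trichotomy
  abs_reChar_le_one)

/-! ### Small tools -/

/-- `2^{ω(d)} ≤ d` for `d ≥ 1`. [folklore] -/
private theorem two_pow_card_primeFactors_le {d : ℕ} (hd : d ≠ 0) : (2 : ℝ) ^ d.primeFactors.card ≤ d := by
  have h1 : 2 ^ d.primeFactors.card ≤ ∏ p ∈ d.primeFactors, p :=
    Finset.pow_card_le_prod _ _ 2 fun p hp => (Nat.prime_of_mem_primeFactors hp).two_le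
  have h2 : ∏ p ∈ d.primeFactors, p ≤ d := Nat.le_of_dvd (Nat.pos_of_ne_zero hd) (Nat.prod_primeFactors_dvd d)
  exact_mod_cast h1.trans h2

/-- The divisors of `(m, P)` are the divisors of `P ≠ 0` dividing `m`. [folklore] -/
theorem divisors_gcd_eq_filter {P : ℕ} (hP : P ≠ 0) (m : ℕ) :
    (Nat.gcd m P).divisors = P.divisors.filter (fun d => d ∣ m) := by
  ext d
  rw [Finset.mem_filter, Nat.mem_divisors, Nat.mem_divisors, Nat.dvd_gcd_iff]
  constructor
  · rintro ⟨⟨hm, hp⟩, -⟩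
    exact ⟨⟨hp, hP⟩, hm⟩
  · rintro ⟨⟨hp, -⟩, hm⟩
    exact ⟨⟨hm, hp⟩, (Nat.gcd_pos_of_pos_right m (Nat.pos_of_ne_zero hP)).ne'⟩

/-- Swapping the sieve sum: `∑_{m ∈ S} a(m) ∑_{d ∣ (m, P)} w(d) = ∑_{d ∣ P} w(d) ∑_{m ∈ S, d ∣ m} a(m)` (`P ≠ 0`).
[folklore] -/
theorem sum_mul_sum_divisors_gcd_eq {P : ℕ} (hP : P ≠ 0) (S : Finset ℕ) (a w : ℕ → ℝ) :
    ∑ m ∈ S, a m * ∑ d ∈ (Nat.gcd m P).divisors, w d =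
      ∑ d ∈ P.divisors, w d * ∑ m ∈ S.filter (fun m => d ∣ m), a m := by
  classical
  have h1 : ∀ m, ∑ d ∈ (Nat.gcd m P).divisors, w d = ∑ d ∈ P.divisors, if d ∣ m then w d else 0 := by
    intro m
    rw [divisors_gcd_eq_filter hP m, Finset.sum_filter]
  simp_rw [h1, Finset.mul_sum, Finset.sum_filter]
  rw [Finset.sum_comm]
  refine Finset.sum_congr rfl fun d _ => ?_
  refine Finset.sum_congr rfl fun m _ => ?_
  split_ifs <;> ring

/-- The upper sieve applied to a non-negative sequence: if all prime factors of `P ≠ 0` are `< z` and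
`a ≥ 0`, then `∑_{m ∈ S, (m, P(z)) = 1} a(m) ≤ ∑_{d ∣ P} μ(d)χ⁺(d) ∑_{m ∈ S, d ∣ m} a(m)` for the upper
`β`-sieve weights `χ⁺ = ind 1 β D` (any `β`, `D`). [folklore] -/
theorem sum_coprime_le_sum_weights {P : ℕ} (hP : P ≠ 0) (hPsq : Squarefree P) {z : ℝ}
    (hPz : ∀ p ∈ P.primeFactors, (p : ℝ) < z) (β D : ℝ) (S : Finset ℕ) {a : ℕ → ℝ} (ha : ∀ m, 0 ≤ a m) :
    ∑ m ∈ S.filter (fun m : ℕ => m.Coprime (primesProdBelow z)), a m ≤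
      ∑ d ∈ P.divisors, (μ d : ℝ) * ind 1 β D d * ∑ m ∈ S.filter (fun m => d ∣ m), a m := by
  classical
  rw [← sum_mul_sum_divisors_gcd_eq hP S a (fun d => (μ d : ℝ) * ind 1 β D d)]
  -- pointwise: `a(m) 𝟙 ≤ a(m) Θ(m)` with `Θ(m) = ∑_{d ∣ (m,P)} μ(d)χ⁺(d) ≥ 𝟙_{(m,P)=1} ≥ 0`
  have hΘ : ∀ m, (if Nat.gcd m P = 1 then (1 : ℝ) else 0) ≤
      ∑ d ∈ (Nat.gcd m P).divisors, (μ d : ℝ) * ind 1 β D d := fun m =>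
    upper_sieve (hPsq.squarefree_of_dvd (Nat.gcd_dvd_right m P))
  have hΘ0 : ∀ m, 0 ≤ ∑ d ∈ (Nat.gcd m P).divisors, (μ d : ℝ) * ind 1 β D d := fun m =>
    le_trans (by split_ifs <;> norm_num) (hΘ m)
  calc ∑ m ∈ S.filter (fun m : ℕ => m.Coprime (primesProdBelow z)), a m
      ≤ ∑ m ∈ S.filter (fun m : ℕ => m.Coprime (primesProdBelow z)),
          a m * ∑ d ∈ (Nat.gcd m P).divisors, (μ d : ℝ) * ind 1 β D d := by
        refine Finset.sum_le_sum fun m hm => ?_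
        rw [Finset.mem_filter] at hm
        -- `(m, P) = 1`
        have hcop : Nat.gcd m P = 1 := by
          refine Nat.Coprime.gcd_eq_one (Nat.coprime_of_dvd fun p hp hpm hpP => ?_)
          have hpz := hPz p (Nat.mem_primeFactors.mpr ⟨hp, hpP, hP⟩)
          have h1 := (coprime_primesProdBelow_iff m z).mp hm.2 p
            (Nat.mem_primesBelow.mpr ⟨Nat.lt_ceil.mpr hpz, hp⟩)
          exact h1 hpm
        have h1 := hΘ m
        rw [if_pos hcop] at h1
        calc a m = a m * 1 := (mul_one _).symm
          _ ≤ _ := mul_le_mul_of_nonneg_left h1 (ha m)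
    _ ≤ ∑ m ∈ S, a m * ∑ d ∈ (Nat.gcd m P).divisors, (μ d : ℝ) * ind 1 β D d :=
        Finset.sum_le_sum_of_subset_of_nonneg (Finset.filter_subset _ _)
          fun m _ _ => mul_nonneg (ha m) (hΘ0 m)

/-- The remainder sum: `∑_{d ∣ P, d < D} c 2^{ω(d)} ≤ c D²` (`c ≥ 0`, `D ≥ 1`). [folklore] -/
theorem sum_divisors_ite_two_pow_le (P : ℕ) {c D : ℝ} (hc : 0 ≤ c) (hD : 1 ≤ D) :
    ∑ d ∈ P.divisors, (if ((d : ℕ) : ℝ) < D then c * (2 : ℝ) ^ (d : ℕ).primeFactors.card else 0) ≤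
      c * D ^ 2 := by
  classical
  have hD0 : 0 ≤ D := by linarith
  rw [← Finset.sum_filter]
  calc ∑ d ∈ P.divisors.filter (fun d : ℕ => (d : ℝ) < D), c * (2 : ℝ) ^ d.primeFactors.card
      ≤ ∑ d ∈ P.divisors.filter (fun d : ℕ => (d : ℝ) < D), c * D := by
        refine Finset.sum_le_sum fun d hd => mul_le_mul_of_nonneg_left ?_ hc
        rw [Finset.mem_filter, Nat.mem_divisors] at hd
        have hd0 : d ≠ 0 := ne_zero_of_dvd_ne_zero hd.1.2 hd.1.1
        exact (two_pow_card_primeFactors_le hd0).trans hd.2.le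
    _ = #(P.divisors.filter (fun d : ℕ => (d : ℝ) < D)) * (c * D) := by rw [Finset.sum_const, nsmul_eq_mul]
    _ ≤ D * (c * D) := by
        refine mul_le_mul_of_nonneg_right ?_ (by positivity)
        have hsub : P.divisors.filter (fun d : ℕ => (d : ℝ) < D) ⊆ Ioc 0 ⌊D⌋₊ := by
          intro d hd
          rw [Finset.mem_filter, Nat.mem_divisors] at hd
          have hd0 : d ≠ 0 := ne_zero_of_dvd_ne_zero hd.1.2 hd.1.1
          rw [Finset.mem_Ioc]
          exact ⟨Nat.pos_of_ne_zero hd0, Nat.le_floor hd.2.le⟩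
        calc (#(P.divisors.filter (fun d : ℕ => (d : ℝ) < D)) : ℝ) ≤ #(Ioc 0 ⌊D⌋₊) := by
              exact_mod_cast Finset.card_le_card hsub
          _ = ⌊D⌋₊ := by rw [Nat.card_Ioc, Nat.sub_zero]
          _ ≤ D := Nat.floor_le hD0
    _ = c * D ^ 2 := by ring

/-! ### The local density `g(p) = (1 + χ(p))/p − χ(p)/p²` -/

/-- `|g(p)| ≤ 2/p` and, for `p ≥ 3`, `g(p) ≤ 2/3`; here `g(p) = (1 + c)/p − c/p²` with `c ∈ {0, ±1}`.
[folklore] -/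
theorem localDensity_bounds {p : ℕ} (hp : 2 ≤ p) {c : ℝ} (hc : c = 0 ∨ c = 1 ∨ c = -1) :
    |(1 + c) / p - c / (p : ℝ) ^ 2| ≤ (2 : ℝ) / p ∧
      (3 ≤ p → (1 + c) / p - c / (p : ℝ) ^ 2 ≤ (2 : ℝ) / 3) := by
  have hp0 : (0 : ℝ) < p := by exact_mod_cast (show 0 < p by omega)
  have hp2 : (2 : ℝ) ≤ p := by exact_mod_cast hp
  have e : (1 + c) / p - c / (p : ℝ) ^ 2 = ((1 + c) * p - c) / (p : ℝ) ^ 2 := by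
    field_simp
  have hnum0 : 0 ≤ (1 + c) * p - c := by rcases hc with rfl | rfl | rfl <;> nlinarith
  have hnum2 : (1 + c) * p - c ≤ 2 * p := by rcases hc with rfl | rfl | rfl <;> nlinarith
  have hg0 : 0 ≤ (1 + c) / p - c / (p : ℝ) ^ 2 := by rw [e]; positivity
  have hg2 : (1 + c) / p - c / (p : ℝ) ^ 2 ≤ (2 : ℝ) / p := by
    rw [e, div_le_div_iff₀ (by positivity) hp0]
    nlinarith
  have key : |(1 + c) / p - c / (p : ℝ) ^ 2| ≤ (2 : ℝ) / p := by
    rw [abs_of_nonneg hg0]; exact hg2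
  refine ⟨key, fun hp3 => ?_⟩
  have hp3' : (3 : ℝ) ≤ p := by exact_mod_cast hp3
  calc (1 + c) / p - c / (p : ℝ) ^ 2 ≤ (2 : ℝ) / p := hg2
    _ ≤ (2 : ℝ) / 3 := div_le_div_of_nonneg_left (by norm_num) (by norm_num) hp3'

/-! ### The density bound -/

set_option maxHeartbeats 1600000 in
/-- **`λ = 1 ∗ χ` on the rough integers at an exceptional zero.**  For `ε > 0` there are `K > 0` and `η₀`
such that for every primitive quadratic `χ (mod q)` with `L(1 − 1/(η log q), χ) = 0`, `η ≥ η₀`, every real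
`z` with `q^{(1+ε)/2} + 1 ≤ z` and every real `y > 0`:
`∑_{1 ≤ m ≤ y, (m, P(z)) = 1} λ(m) ≤ K (y/(η log q) + q z^{124} √y)`, `λ = charDivisorSum χ`,
`P(z) = primesProdBelow z` (the upper `β`-sieve — Matomäki–Merikoski Lemma 3.2 (ii) for the main term —
fed with Davenport's mean value on multiples of `d` and Tao–Teräväinen's (3.15); see the module docstring).
[folklore] -/
theorem sum_rough_charDivisorSum_le_of_exceptionalZero {ε : ℝ} (hε : 0 < ε) :
    ∃ K η₀ : ℝ, 0 < K ∧ ∀ (q : ℕ) [NeZero q] (χ : DirichletCharacter ℂ q), χ.IsPrimitive → χ ^ 2 = 1 →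
      ∀ η : ℝ, η₀ ≤ η → χ.LFunction ((1 - 1 / (η * Real.log q) : ℝ) : ℂ) = 0 →
        ∀ z y : ℝ, (q : ℝ) ^ ((1 + ε) / 2) + 1 ≤ z → 0 < y →
          ∑ m ∈ (Ioc 0 ⌊y⌋₊).filter (fun m : ℕ => m.Coprime (primesProdBelow z)), charDivisorSum χ m ≤
            K * (y / (η * Real.log q) + q * z ^ (124 : ℕ) * Real.sqrt y) := by
  classical
  obtain ⟨η₀, HT⟩ := SiegelZero.exists_LFunction_one_mul_siftedEuler_le (ε := ε) hε
  -- the sieve constant at `A = 1`, `β = 62`, `log D/log z = 62`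
  set C₁ : ℝ := 3 * Real.exp (24 * ((6 : ℝ) + 2 ^ (1 + 1))) * Real.exp (((1 : ℕ) : ℝ) * (62 : ℝ) / 2) *
      Real.exp (-((1 : ℕ) : ℝ) * (62 : ℝ) / 2) with hC₁
  have hC₁0 : 0 < C₁ := by positivity
  refine ⟨16 * (1 + C₁) + 5, η₀, by positivity, ?_⟩
  intro q _ χ hprim hsq η hη hL z y hz hy
  -- basic facts
  have hq2 : 2 ≤ q := SiegelZero.two_le_of_LFunction_eq_zero hL
  have hχ1 : χ ≠ 1 := CharacterTails.ne_one_of_isPrimitive χ hprim hq2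
  have hqr : (2 : ℝ) ≤ q := by exact_mod_cast hq2
  have hq1 : (1 : ℝ) < q := by linarith
  have hq0 : (0 : ℝ) < q := by linarith
  have hpow1 : (1 : ℝ) < (q : ℝ) ^ ((1 + ε) / 2) := Real.one_lt_rpow hq1 (by positivity)
  have hz2 : (2 : ℝ) < z := by linarith
  have hz1 : (1 : ℝ) < z := by linarith
  have hz0 : (0 : ℝ) < z := by linarith
  have hlogz : 0 < Real.log z := Real.log_pos hz1
  have hη0 : 0 < η := SiegelZero.eta_pos_of_LFunction_eq_zero χ hχ1 hL
  have hlogq : 0 < Real.log q := Real.log_pos hq1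
  have hηlq : 0 < η * Real.log q := mul_pos hη0 hlogq
  have hLpos : 0 < (χ.LFunction 1).re := Siegel.LFunction_one_re_pos χ hχ1 hsq
  set L : ℝ := (χ.LFunction 1).re with hLdef
  set N : ℕ := ⌊y⌋₊ with hN
  have hsy : 0 ≤ Real.sqrt y := Real.sqrt_nonneg y
  -- the odd sifting range `P = ∏_{2 < p < z} p`
  set P : ℕ := ∏ p ∈ (Nat.primesBelow ⌈z⌉₊).filter (fun p : ℕ => ¬ p ∣ 2), p with hPdef
  have hPsq : Squarefree P := squarefree_prod_primesBelow_filter z 2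
  have hP0 : P ≠ 0 := hPsq.ne_zero
  have hPf : ∀ p ∈ P.primeFactors, p.Prime ∧ (p : ℝ) < z ∧ ¬ p ∣ 2 := fun p hp =>
    mem_primeFactors_prod_primesBelow_filter.mp hp
  have hPz : ∀ p ∈ P.primeFactors, (p : ℝ) < z := fun p hp => (hPf p hp).2.1
  have hP3 : ∀ p ∈ P.primeFactors, 3 ≤ p := by
    intro p hp
    obtain ⟨hpp, -, hp2⟩ := hPf p hp
    have h2 := hpp.two_le
    have hne : p ≠ 2 := fun h => hp2 (h ▸ dvd_rfl)
    omega
  -- the level `D = z^62`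
  set D : ℝ := z ^ (62 : ℕ) with hDdef
  have hD1 : 1 < D := one_lt_pow₀ hz1 (by norm_num)
  have hD0 : 0 < D := by linarith
  have hlogD : Real.log D = 62 * Real.log z := by rw [hDdef, Real.log_pow]; norm_num
  have hzD : (62 : ℝ) * Real.log z ≤ Real.log D := by rw [hlogD]
  have hβ : (1 : ℝ) < 62 := by norm_num
  -- the multiplicative density `g`
  set gp : ℕ → ℝ := fun p => (1 + reChar χ p) / p - reChar χ p / (p : ℝ) ^ 2 with hgp
  obtain ⟨g, hgm, hg⟩ := exists_mulFn gp 1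
  have hg' : ∀ d : ℕ, d ≠ 0 → g d = ∏ p ∈ d.primeFactors, gp p := by
    intro d hd
    rw [hg d hd, if_pos (Nat.coprime_one_right d)]
  have hgprime : ∀ p : ℕ, p.Prime → g p = gp p := by
    intro p hp
    rw [hg' p hp.ne_zero, hp.primeFactors, Finset.prod_singleton]
  have hg1 : ∀ p ∈ P.primeFactors, |g p| ≤ 2 / p := by
    intro p hp
    have hpp := (hPf p hp).1
    rw [hgprime p hpp]
    exact (localDensity_bounds hpp.two_le (reChar_trichotomy χ hsq p)).1
  have hg2 : ∀ p ∈ P.primeFactors, g p ≤ 2 / 3 := by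
    intro p hp
    have hpp := (hPf p hp).1
    rw [hgprime p hpp]
    exact (localDensity_bounds hpp.two_le (reChar_trichotomy χ hsq p)).2 (hP3 p hp)
  -- Step 1: the sieve
  have h1 := sum_coprime_le_sum_weights hP0 hPsq hPz 62 D (Ioc 0 N)
    (a := fun m => charDivisorSum χ m) (fun m => charDivisorSum_nonneg χ hsq m)
  -- Step 2: each `d`-sum is `L y g(d) + O(5q 2^{ω(d)} √y)`, and the weight vanishes for `d ≥ D`
  have h2 : ∀ d ∈ P.divisors, (μ d : ℝ) * ind 1 62 D d *
      ∑ m ∈ (Ioc 0 N).filter (fun m => d ∣ m), charDivisorSum χ m ≤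
      L * y * ((μ d : ℝ) * ind 1 62 D d * g d) +
        (if ((d : ℕ) : ℝ) < D then 5 * q * (2 : ℝ) ^ (d : ℕ).primeFactors.card * Real.sqrt y else 0) := by
    intro d hd
    rw [Nat.mem_divisors] at hd
    have hd0 : d ≠ 0 := ne_zero_of_dvd_ne_zero hd.2 hd.1
    have hdsq : Squarefree d := hPsq.squarefree_of_dvd hd.1
    have hdz : ∀ p ∈ d.primeFactors, (p : ℝ) < z := fun p hp =>
      hPz p (Nat.primeFactors_mono hd.1 hP0 hp)
    have hT := abs_sum_multiples_charDivisorSum_sub_le χ hχ1 hsq hdsq hy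
    rw [← hN, ← hg' d hd0] at hT
    set w : ℝ := (μ d : ℝ) * ind 1 62 D d with hw
    set Ad : ℝ := ∑ m ∈ (Ioc 0 N).filter (fun m => d ∣ m), charDivisorSum χ m with hAd
    have hw1 : |w| ≤ 1 := abs_moebius_mul_ind_le_one 1 62 D d
    have hsplit : w * Ad = L * y * (w * g d) + w * (Ad - L * y * g d) := by ring
    rw [hsplit]
    refine add_le_add le_rfl ?_
    by_cases hdD : (d : ℝ) < D
    · rw [if_pos hdD]
      calc w * (Ad - L * y * g d) ≤ |w * (Ad - L * y * g d)| := le_abs_self _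
        _ = |w| * |Ad - L * y * g d| := abs_mul _ _
        _ ≤ 1 * (5 * q * (2 : ℝ) ^ d.primeFactors.card * Real.sqrt y) :=
            mul_le_mul hw1 hT (abs_nonneg _) zero_le_one
        _ = _ := one_mul _
    · rw [if_neg hdD]
      have hind : ind 1 62 D d = 0 :=
        ind_eq_zero_of_level_le hβ hD1 hzD hdsq hdz (not_lt.mp hdD)
      rw [hw, hind, mul_zero, zero_mul]
  -- Step 3: sum over `d`
  have h3 : ∑ d ∈ P.divisors, (μ d : ℝ) * ind 1 62 D d *
      ∑ m ∈ (Ioc 0 N).filter (fun m => d ∣ m), charDivisorSum χ m ≤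
      L * y * ∑ d ∈ P.divisors, (μ d : ℝ) * ind 1 62 D d * g d + 5 * q * Real.sqrt y * D ^ 2 := by
    refine (Finset.sum_le_sum h2).trans ?_
    rw [Finset.sum_add_distrib, ← Finset.mul_sum]
    refine add_le_add le_rfl ?_
    have := sum_divisors_ite_two_pow_le P (c := 5 * q * Real.sqrt y) (by positivity) hD1.le
    refine le_trans (le_of_eq ?_) this
    refine Finset.sum_congr rfl fun d _ => ?_
    split_ifs <;> ring
  -- Step 4: the main term of the sieve (Lemma 3.2 (ii) with `A = 1`, `β = 62`)
  have h4 : ∑ d ∈ P.divisors, (μ d : ℝ) * ind 1 62 D d * g d ≤ (1 + C₁) * vprod g P := by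
    have hmain := abs_upperSieveSum_sub_vprod_le (g := g) hPsq hβ hz1 hD1 hzD hPz hgm hg1 hg2
      (A := 1) le_rfl (by norm_num)
    have hratio : Real.log D / Real.log z = 62 := by rw [hlogD]; field_simp
    rw [hratio] at hmain
    have hV0 : 0 < vprod g P := vprod_pos_of_le hg2
    have h' := (abs_le.mp hmain).2
    have e : 3 * Real.exp (24 * ((6 : ℝ) + 2 ^ (1 + 1))) * Real.exp (((1 : ℕ) : ℝ) * 62 / 2) *
        Real.exp (-((1 : ℕ) : ℝ) * 62 / 2) * vprod g P = C₁ * vprod g P := by rw [hC₁]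
    rw [e] at h'
    linarith
  -- Step 5: `vprod g P = ∏_{2<p<z} (1 − 1/p)(1 − χ(p)/p) ≤ 4 ∏_{p<z} (…)`, and the zero
  set f : ℕ → ℝ := fun p => (1 - (p : ℝ)⁻¹) * (1 - (χ p).re * (p : ℝ)⁻¹) with hf
  have hfg : ∀ p : ℕ, p.Prime → 1 - g p = f p := by
    intro p hp
    rw [hgprime p hp, hgp]
    simp only
    rw [one_sub_localDensity p (reChar χ p), reChar_apply χ hp.ne_zero, hf]
    simp only
    ring
  have hvprod : vprod g P = ∏ p ∈ P.primeFactors, f p := by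
    rw [vprod]
    exact Finset.prod_congr rfl fun p hp => hfg p (hPf p hp).1
  set M : ℕ := ⌈z⌉₊ with hM
  have hzM : z ≤ M := Nat.le_ceil z
  have hMz : (q : ℝ) ^ ((1 + ε) / 2) + 1 ≤ M := hz.trans hzM
  have hE := HT q χ hprim hsq η hη hL M hMz
  -- `P.primeFactors = (primes < M) \ {2}` and `2 < M`
  have h2M : 2 ∈ M.primesBelow := by
    rw [Nat.mem_primesBelow]
    exact ⟨Nat.lt_ceil.mpr (by exact_mod_cast hz2), Nat.prime_two⟩
  have hPM : P.primeFactors = M.primesBelow.erase 2 := by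
    ext p
    rw [Finset.mem_erase, Nat.mem_primesBelow, hPdef, mem_primeFactors_prod_primesBelow_filter, hM,
      Nat.lt_ceil]
    constructor
    · rintro ⟨hp, hpz, hp2⟩
      exact ⟨fun h => hp2 (h ▸ dvd_rfl), hpz, hp⟩
    · rintro ⟨hp2, hpz, hp⟩
      refine ⟨hp, hpz, fun h => hp2 ?_⟩
      exact (Nat.prime_dvd_prime_iff_eq hp Nat.prime_two).mp h
  have hfpos : ∀ p : ℕ, p.Prime → 0 < f p := by
    intro p hp
    have hp1 : (1 : ℝ) < p := by exact_mod_cast hp.one_lt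
    have hp0 : (0 : ℝ) < p := by linarith
    have hinv : (p : ℝ)⁻¹ < 1 := inv_lt_one_of_one_lt₀ hp1
    have hinv0 : 0 ≤ (p : ℝ)⁻¹ := by positivity
    refine mul_pos (by linarith) ?_
    have : (χ p).re * (p : ℝ)⁻¹ ≤ 1 * (p : ℝ)⁻¹ :=
      mul_le_mul_of_nonneg_right ((le_abs_self _).trans
        (SmoothEulerProduct.abs_apply_re_le_one χ p)) hinv0
    linarith
  have hflow : ∀ p : ℕ, p.Prime → (1 - (p : ℝ)⁻¹) ^ 2 ≤ f p := by
    intro p hp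
    have hp1 : (1 : ℝ) < p := by exact_mod_cast hp.one_lt
    have hinv : (p : ℝ)⁻¹ < 1 := inv_lt_one_of_one_lt₀ hp1
    have hinv0 : 0 ≤ (p : ℝ)⁻¹ := by positivity
    have hc : (χ p).re ≤ 1 := (le_abs_self _).trans (SmoothEulerProduct.abs_apply_re_le_one χ p)
    have h1 : 1 - (p : ℝ)⁻¹ ≤ 1 - (χ p).re * (p : ℝ)⁻¹ := by nlinarith
    have h0 : 0 ≤ 1 - (p : ℝ)⁻¹ := by linarith
    rw [hf]
    simp only
    rw [sq]
    exact mul_le_mul_of_nonneg_left h1 h0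
  have hf2 : 1 / 4 ≤ f 2 := by
    have := hflow 2 Nat.prime_two
    norm_num at this
    linarith
  have hprodM : ∏ p ∈ M.primesBelow, f p = f 2 * ∏ p ∈ P.primeFactors, f p := by
    rw [hPM, Finset.mul_prod_erase _ _ h2M]
  have hprodP0 : 0 ≤ ∏ p ∈ P.primeFactors, f p :=
    Finset.prod_nonneg fun p hp => (hfpos p (hPf p hp).1).le
  have h5 : L * vprod g P ≤ 16 / (η * Real.log q) := by
    rw [hvprod]
    have hE' : L * (f 2 * ∏ p ∈ P.primeFactors, f p) ≤ 4 / (η * Real.log q) := by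
      rw [← hprodM]; exact hE
    -- divide by `f 2 ≥ 1/4`
    have hf20 : 0 < f 2 := hfpos 2 Nat.prime_two
    have hkey : L * ∏ p ∈ P.primeFactors, f p = (L * (f 2 * ∏ p ∈ P.primeFactors, f p)) / f 2 := by
      field_simp
    rw [hkey, div_le_iff₀ hf20]
    calc L * (f 2 * ∏ p ∈ P.primeFactors, f p) ≤ 4 / (η * Real.log q) := hE'
      _ = 16 / (η * Real.log q) * (1 / 4) := by ring
      _ ≤ 16 / (η * Real.log q) * f 2 := mul_le_mul_of_nonneg_left hf2 (by positivity)
  -- Step 6: assemble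
  have hV0 : 0 ≤ vprod g P := by rw [hvprod]; exact hprodP0
  calc _ ≤ _ := h1
    _ ≤ L * y * ∑ d ∈ P.divisors, (μ d : ℝ) * ind 1 62 D d * g d + 5 * q * Real.sqrt y * D ^ 2 := h3
    _ ≤ L * y * ((1 + C₁) * vprod g P) + 5 * q * Real.sqrt y * D ^ 2 := by
        refine add_le_add (mul_le_mul_of_nonneg_left h4 (by positivity)) le_rfl
    _ = (1 + C₁) * y * (L * vprod g P) + 5 * q * Real.sqrt y * D ^ 2 := by ring
    _ ≤ (1 + C₁) * y * (16 / (η * Real.log q)) + 5 * q * Real.sqrt y * D ^ 2 := by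
        refine add_le_add (mul_le_mul_of_nonneg_left h5 (by positivity)) le_rfl
    _ = 16 * (1 + C₁) * (y / (η * Real.log q)) + 5 * (q * z ^ (124 : ℕ) * Real.sqrt y) := by
        rw [hDdef, ← pow_mul]; ring
    _ ≤ (16 * (1 + C₁) + 5) * (y / (η * Real.log q)) +
          (16 * (1 + C₁) + 5) * (q * z ^ (124 : ℕ) * Real.sqrt y) := by
        have ha : 0 ≤ y / (η * Real.log q) := by positivity
        have hb : 0 ≤ (q : ℝ) * z ^ (124 : ℕ) * Real.sqrt y := by positivity
        nlinarith
    _ = (16 * (1 + C₁) + 5) * (y / (η * Real.log q) + q * z ^ (124 : ℕ) * Real.sqrt y) := by ring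

end Literature.Barriers.Parity.MatomakiMerikoski
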